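import Mathlib
import HarnessLib
import Summits.Ventures.LatticeQCDFlow.Exactness.Phi4HMCFluctuationRelation
import Summits.Ventures.LatticeQCDFlow.Exactness.AcceptanceFromMeanEnergyViolation
import Summits.Ventures.LatticeQCDFlow.Exactness.SUNWilsonHMCForce
import Summits.Ventures.LatticeQCDFlow.Exactness.SUNMultiStepLeapfrogHMCEngine
import Summits.Ventures.LatticeQCDFlow.Exactness.OpenBoundaryWilsonAction
import Summits.Ventures.LatticeQCDFlow.Exactness.CabibboMarinariORSweep

/-!
# The fluctuation relation, the equilibrium acceptance `P(ΔH ≤ 0) + P(ΔH < 0)` and the negative tail `≤ e^{−c}` of the energy violation of the engine's multi-step `SU(N)` HMC — periodic arm with its own Wilson force, open-boundary arm with any increment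

HONEST FRAMING: exact (Metropolis-corrected) sampling algorithms for lattice gauge theory;
figures of merit are autocorrelation/cost numbers at stated couplings and volumes; no
continuum-physics claim.

Venture `LatticeQCDFlow` (cell pub-lqcd), topic `Exactness`, FANOUT row 21 (`su3-base`: arms `E2 = PBC-HMC` and
`OBC-HMC`, the engine `latflow.core.hmc.HMC(f, β, 'leapfrog').trajectory(τ, nstep)` on `SU(3)`; the row's acceptance item
(h) reads "`⟨e^{−ΔH}⟩ = 1 ± 2σ`, reversibility event, `P_acc`" over the production trajectories, and the E2 pre-run rule
picks the number of steps `n_md` from a scan of `P_acc`).  NEW WORK of the cell over the tree: row 2's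
`Phi4HMCFluctuationRelation` (and `AcceptanceFromMeanEnergyViolation`, `involutive_acceptance_ge`) proved, for an ABSTRACT measure-preserving measurable involution `Ψ` and a measurable `H` with
`e^{−H}` integrable, the fluctuation relation `∫ g(ΔH) e^{−H} = ∫ g(−ΔH) e^{−ΔH} e^{−H}`, the acceptance identity
`∫ min(1, e^{−ΔH}) e^{−H} = ∫ 𝟙[ΔH ≤ 0] e^{−H} + ∫ 𝟙[ΔH < 0] e^{−H}` and the negative tail
`∫ 𝟙[ΔH ≤ −c] e^{−H} ≤ e^{−c} ∫ 𝟙[ΔH ≥ c] e^{−H}`, and instantiated them for row 2's scalar HMC; row 9's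
`SUNMultiStepLeapfrogHMC` supplies the engine's `n`-step `SU(N)` proposal `sunLeapfrogProposalN` = `flip ∘ (K D K)ⁿ` with
`involutive_` / `measurable_` / `measurePreserving_sunLeapfrogProposalN` (for `Haar^{⊗links} ⊗ μ^{⊗links}`, `μ` any
additive Haar measure on the engine's coordinates `SUNCoords N`); `SUNMultiStepLeapfrogHMCEngine` the kinetic term
`sunKinetic` (`sunMomentumWeight_sunKinetic_ne_top`); row 21's `SUNWilsonHMCForce` (`measurable_sunWilsonForce`,
`measurable_halfKick_sun`, `exists_bound_smul_wilsonAction_sun`) and `OpenBoundaryWilsonAction` (`obcAction`,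
`exists_bound_smul_obcAction`).  The engine's `SU(N)` kernel with ITS OWN momenta was not instantiated; it is here.
Def-free; nothing is cited as a fact; no number.

## What is proved (`G = SU(N)`, links indexed by a finite type, reference measure `μ₀ = Haar^{⊗links} ⊗ μ^{⊗links}`,
## `H(U, p) = S(U) + T(p)` with `T = sunKinetic`, `ΔH = H ∘ Ψ − H` (`deltaH`), `Ψ = sunLeapfrogProposalN … ε g n`)

* `integrable_exp_neg_hamiltonian_sun` — `e^{−H}` is `μ₀`-integrable (`e^{−S}` integrable for `Haar^⊗`);
  `integrable_exp_neg_smul_wilsonAction_sun`, `integrable_exp_neg_smul_obcAction_sun` (the two arms' weights).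
* **`sun_leapfrogN_fluctuation_relation`** — for ANY measurable increment `g`, any `ε`, `n`, EVERY `g₀ : ℝ → ℝ` and every
  real-valued `S` (no hypothesis on `S` at all): `∫ g₀(ΔH) e^{−H} dμ₀ = ∫ g₀(−ΔH) e^{−ΔH} e^{−H} dμ₀`.
* **`sun_leapfrogN_acceptance_eq`** — measurable `S` with `e^{−S}` integrable: THE EQUILIBRIUM ACCEPTANCE IS
  `P(ΔH ≤ 0) + P(ΔH < 0)`: `∫ min(1, e^{−ΔH}) e^{−H} dμ₀ = ∫ 𝟙[ΔH ≤ 0] e^{−H} dμ₀ + ∫ 𝟙[ΔH < 0] e^{−H} dμ₀`.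
* **`sun_leapfrogN_acceptance_ge`** — under the first-moment hypothesis `ΔH·e^{−H} ∈ L¹`: the Bretagnolle–Huber bound of
  row 2's `AcceptanceFromMeanEnergyViolation`, `(1 − √(1 − e^{−⟨ΔH⟩}))·Z ≤ ∫ min(1, e^{−ΔH}) e^{−H} dμ₀`
  (`1 − ⟨P_acc⟩ ≤ √(1 − e^{−⟨ΔH⟩}) ≤ √⟨ΔH⟩`, no Gaussian model), for the engine's `SU(N)` kernel.
* **`sun_leapfrogN_negative_tail_le`** — `∫ 𝟙[ΔH ≤ −c] e^{−H} dμ₀ ≤ e^{−c} ∫ 𝟙[c ≤ ΔH] e^{−H} dμ₀` for every real `c`: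
  in equilibrium `P(ΔH ≤ −c) ≤ e^{−c}`, whatever the step size and the number of steps.
* §3 ROW 21's ARMS AS RUN: **`wilsonForce_sunLeapfrogN_acceptance_eq`** / **`_negative_tail_le`** (periodic arm,
  `S = β·S_W`, the engine's own half kick `−(ε/2)·sunWilsonForce N β`, every `β`, `ε`, `n`, `L`);
  **`obc_sunLeapfrogN_acceptance_eq`** / **`_negative_tail_le`** (open-boundary arm, `S = β·S_OBC`, any time direction,
  ANY measurable increment).
So the scanned `P_acc` of the pre-run rule is, in equilibrium, exactly `2·P(ΔH < 0) + P(ΔH = 0)` — a histogram of `ΔH`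
whose negative half carries more than `e^{−c}` mass below `−c` indicts the implementation, for every `n_md`.
NOT CLAIMED: the Gaussian law of `ΔH`, the `erfc` formula for `P_acc`, the dependence of `P_acc` on `ε`, `n` (measured);
anything in floating point; autocorrelations.
-/

noncomputable section

namespace Summit.Ventures.LatticeQCDFlow.Exactness

open MeasureTheory Set Function
open Literature.MathematicalPhysics.QuantumFieldTheory
open scoped ENNReal

set_option backward.isDefEq.respectTransparency false

/-! ## §1 Integrability of the Boltzmann weights -/

section Weights

variable (N : ℕ) {L : Type*} [Fintype L] (μ : Measure (SUNCoords N)) [μ.IsAddHaarMeasure]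

/-- **`e^{−H}` is `μ₀`-integrable** for `H(U, p) = S(U) + T(p)` whenever `e^{−S}` is `Haar^⊗`-integrable (`e^{−T}` is
`μ^⊗`-integrable because `Z_T < ∞`, `sunMomentumWeight_sunKinetic_ne_top`). -/
theorem integrable_exp_neg_hamiltonian_sun {S : (L → Matrix.specialUnitaryGroup (Fin N) ℂ) → ℝ}
    (hSi : Integrable (fun U => Real.exp (-S U))
      (Measure.pi fun _ : L => haarProbability (Matrix.specialUnitaryGroup (Fin N) ℂ))) :
    Integrable (fun z : (L → Matrix.specialUnitaryGroup (Fin N) ℂ) × (L → SUNCoords N) =>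
        Real.exp (-(S z.1 + sunKinetic N z.2)))
      ((Measure.pi fun _ : L => haarProbability (Matrix.specialUnitaryGroup (Fin N) ℂ)).prod
        (Measure.pi fun _ : L => μ)) := by
  haveI : SigmaFinite μ := inferInstance
  have hT : Integrable (fun p : L → SUNCoords N => Real.exp (-sunKinetic N p)) (Measure.pi fun _ : L => μ) := by
    refine ⟨(Real.measurable_exp.comp (measurable_sunKinetic (L := L) N).neg).aestronglyMeasurable, ?_⟩
    rw [hasFiniteIntegral_iff_ofReal (ae_of_all _ fun p => (Real.exp_pos _).le)]
    have h := sunMomentumWeight_sunKinetic_ne_top N (L := L) μ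
    rw [sunMomentumWeight, withDensity_apply _ MeasurableSet.univ, Measure.restrict_univ] at h
    exact lt_top_iff_ne_top.2 h
  refine (hSi.mul_prod hT).congr (ae_of_all _ fun z => ?_)
  simp only [neg_add, Real.exp_add]

/-- The reference measure `μ₀ = Haar^{⊗links} ⊗ μ^{⊗links}` is not the zero measure (the Haar product is a probability and
each momentum factor charges the whole space). -/
theorem neZero_haarPi_prod_pi :
    NeZero ((Measure.pi fun _ : L => haarProbability (Matrix.specialUnitaryGroup (Fin N) ℂ)).prod
      (Measure.pi fun _ : L => μ)) := by
  haveI : SigmaFinite μ := inferInstance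
  refine ⟨fun h => ?_⟩
  have h1 : ((Measure.pi fun _ : L => haarProbability (Matrix.specialUnitaryGroup (Fin N) ℂ)).prod
      (Measure.pi fun _ : L => μ)) (Set.univ ×ˢ Set.univ) = 0 := by
    rw [h, Measure.coe_zero, Pi.zero_apply]
  rw [Measure.prod_prod, measure_univ, one_mul, ← Set.pi_univ (Set.univ : Set L), Measure.pi_pi,
    Finset.prod_eq_zero_iff] at h1
  obtain ⟨l, -, hl⟩ := h1
  exact (NeZero.ne (μ univ)) hl

end Weights

/-! ## §2 The fluctuation relation, the acceptance identity and the negative tail for the engine's `n`-step proposal -/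

section General

variable (N : ℕ) {L : Type*} [Fintype L] (μ : Measure (SUNCoords N)) [μ.IsAddHaarMeasure]

/-- **THE FLUCTUATION RELATION OF `ΔH` FOR THE ENGINE'S MULTI-STEP `SU(N)` HMC**: for every measurable increment `g`,
every `ε`, `n`, every `S` and EVERY `g₀ : ℝ → ℝ`, `∫ g₀(ΔH) e^{−H} dμ₀ = ∫ g₀(−ΔH) e^{−ΔH} e^{−H} dμ₀`. -/
theorem sun_leapfrogN_fluctuation_relation (ε : ℝ) (n : ℕ)
    {g : (L → Matrix.specialUnitaryGroup (Fin N) ℂ) → L → SUNCoords N} (hg : Measurable g)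
    (S : (L → Matrix.specialUnitaryGroup (Fin N) ℂ) → ℝ) (g₀ : ℝ → ℝ) :
    ∫ z, g₀ (deltaH (fun z => S z.1 + sunKinetic N z.2) (sunLeapfrogProposalN (sunCoordι N) (sunCoordι_skew N) ε g n) z) *
        Real.exp (-(S z.1 + sunKinetic N z.2))
      ∂((Measure.pi fun _ : L => haarProbability (Matrix.specialUnitaryGroup (Fin N) ℂ)).prod
        (Measure.pi fun _ : L => μ)) =
    ∫ z, g₀ (-deltaH (fun z => S z.1 + sunKinetic N z.2) (sunLeapfrogProposalN (sunCoordι N) (sunCoordι_skew N) ε g n) z) *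
        Real.exp (-deltaH (fun z => S z.1 + sunKinetic N z.2)
          (sunLeapfrogProposalN (sunCoordι N) (sunCoordι_skew N) ε g n) z) *
        Real.exp (-(S z.1 + sunKinetic N z.2))
      ∂((Measure.pi fun _ : L => haarProbability (Matrix.specialUnitaryGroup (Fin N) ℂ)).prod
        (Measure.pi fun _ : L => μ)) :=
  integral_comp_deltaH_eq (H := fun z => S z.1 + sunKinetic N z.2)
    (measurable_sunLeapfrogProposalN (sunCoordι N) (sunCoordι_skew N) ε n hg)
    (involutive_sunLeapfrogProposalN (sunCoordι N) (sunCoordι_skew N) ε g n)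
    (measurePreserving_sunLeapfrogProposalN (sunCoordι N) (sunCoordι_skew N) ε n μ hg) g₀

/-- **THE EQUILIBRIUM ACCEPTANCE OF THE ENGINE'S MULTI-STEP `SU(N)` HMC IS `P(ΔH ≤ 0) + P(ΔH < 0)`**: for every
measurable increment `g`, every `ε`, `n`, every measurable `S` with `e^{−S}` integrable for `Haar^⊗`,
`∫ min(1, e^{−ΔH}) e^{−H} dμ₀ = ∫ 𝟙[ΔH ≤ 0] e^{−H} dμ₀ + ∫ 𝟙[ΔH < 0] e^{−H} dμ₀`. -/
theorem sun_leapfrogN_acceptance_eq (ε : ℝ) (n : ℕ)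
    {g : (L → Matrix.specialUnitaryGroup (Fin N) ℂ) → L → SUNCoords N} (hg : Measurable g)
    {S : (L → Matrix.specialUnitaryGroup (Fin N) ℂ) → ℝ} (hS : Measurable S)
    (hSi : Integrable (fun U => Real.exp (-S U))
      (Measure.pi fun _ : L => haarProbability (Matrix.specialUnitaryGroup (Fin N) ℂ))) :
    ∫ z, min 1 (Real.exp (-deltaH (fun z => S z.1 + sunKinetic N z.2)
          (sunLeapfrogProposalN (sunCoordι N) (sunCoordι_skew N) ε g n) z)) * Real.exp (-(S z.1 + sunKinetic N z.2))
      ∂((Measure.pi fun _ : L => haarProbability (Matrix.specialUnitaryGroup (Fin N) ℂ)).prod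
        (Measure.pi fun _ : L => μ)) =
    (∫ z, (if deltaH (fun z => S z.1 + sunKinetic N z.2)
          (sunLeapfrogProposalN (sunCoordι N) (sunCoordι_skew N) ε g n) z ≤ 0 then (1 : ℝ) else 0) *
        Real.exp (-(S z.1 + sunKinetic N z.2))
      ∂((Measure.pi fun _ : L => haarProbability (Matrix.specialUnitaryGroup (Fin N) ℂ)).prod
        (Measure.pi fun _ : L => μ))) +
    ∫ z, (if deltaH (fun z => S z.1 + sunKinetic N z.2)
          (sunLeapfrogProposalN (sunCoordι N) (sunCoordι_skew N) ε g n) z < 0 then (1 : ℝ) else 0) *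
        Real.exp (-(S z.1 + sunKinetic N z.2))
      ∂((Measure.pi fun _ : L => haarProbability (Matrix.specialUnitaryGroup (Fin N) ℂ)).prod
        (Measure.pi fun _ : L => μ)) :=
  acceptance_integral_eq (H := fun z => S z.1 + sunKinetic N z.2)
    ((hS.comp measurable_fst).add ((measurable_sunKinetic (L := L) N).comp measurable_snd))
    (measurable_sunLeapfrogProposalN (sunCoordι N) (sunCoordι_skew N) ε n hg)
    (involutive_sunLeapfrogProposalN (sunCoordι N) (sunCoordι_skew N) ε g n)
    (measurePreserving_sunLeapfrogProposalN (sunCoordι N) (sunCoordι_skew N) ε n μ hg)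
    (integrable_exp_neg_hamiltonian_sun N μ hSi)

/-- **THE NEGATIVE TAIL OF `ΔH` IS EXPONENTIALLY SMALL IN EQUILIBRIUM**: for every measurable increment, every `ε`, `n`,
every measurable `S` with `e^{−S}` integrable and every real `c`,
`∫ 𝟙[ΔH ≤ −c] e^{−H} dμ₀ ≤ e^{−c} · ∫ 𝟙[c ≤ ΔH] e^{−H} dμ₀` (so `P(ΔH ≤ −c) ≤ e^{−c}`). -/
theorem sun_leapfrogN_negative_tail_le (ε : ℝ) (n : ℕ)
    {g : (L → Matrix.specialUnitaryGroup (Fin N) ℂ) → L → SUNCoords N} (hg : Measurable g)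
    {S : (L → Matrix.specialUnitaryGroup (Fin N) ℂ) → ℝ} (hS : Measurable S)
    (hSi : Integrable (fun U => Real.exp (-S U))
      (Measure.pi fun _ : L => haarProbability (Matrix.specialUnitaryGroup (Fin N) ℂ))) (c : ℝ) :
    ∫ z, (if deltaH (fun z => S z.1 + sunKinetic N z.2)
          (sunLeapfrogProposalN (sunCoordι N) (sunCoordι_skew N) ε g n) z ≤ -c then (1 : ℝ) else 0) *
        Real.exp (-(S z.1 + sunKinetic N z.2))
      ∂((Measure.pi fun _ : L => haarProbability (Matrix.specialUnitaryGroup (Fin N) ℂ)).prod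
        (Measure.pi fun _ : L => μ)) ≤
    Real.exp (-c) *
      ∫ z, (if c ≤ deltaH (fun z => S z.1 + sunKinetic N z.2)
            (sunLeapfrogProposalN (sunCoordι N) (sunCoordι_skew N) ε g n) z then (1 : ℝ) else 0) *
          Real.exp (-(S z.1 + sunKinetic N z.2))
        ∂((Measure.pi fun _ : L => haarProbability (Matrix.specialUnitaryGroup (Fin N) ℂ)).prod
          (Measure.pi fun _ : L => μ)) :=
  negative_tail_integral_le (H := fun z => S z.1 + sunKinetic N z.2)
    ((hS.comp measurable_fst).add ((measurable_sunKinetic (L := L) N).comp measurable_snd))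
    (measurable_sunLeapfrogProposalN (sunCoordι N) (sunCoordι_skew N) ε n hg)
    (involutive_sunLeapfrogProposalN (sunCoordι N) (sunCoordι_skew N) ε g n)
    (measurePreserving_sunLeapfrogProposalN (sunCoordι N) (sunCoordι_skew N) ε n μ hg)
    (integrable_exp_neg_hamiltonian_sun N μ hSi) c


/-- **THE EQUILIBRIUM ACCEPTANCE OF THE ENGINE'S MULTI-STEP `SU(N)` HMC FROM ITS MEAN ENERGY VIOLATION**:
`(1 − √(1 − e^{−⟨ΔH⟩})) · Z ≤ ∫ min(1, e^{−ΔH}) e^{−H} dμ₀`, `⟨ΔH⟩ = Z⁻¹∫ ΔH e^{−H} dμ₀`, `Z = ∫ e^{−H} dμ₀` — for every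
measurable increment, every `ε`, `n`, every measurable `S` with `e^{−S}` integrable, under the first-moment hypothesis
`ΔH·e^{−H} ∈ L¹` (row 2's `involutive_acceptance_ge`, the Bretagnolle–Huber form of `1 − ⟨P_acc⟩ ≤ √⟨ΔH⟩`; no Gaussian model). -/
theorem sun_leapfrogN_acceptance_ge (ε : ℝ) (n : ℕ)
    {g : (L → Matrix.specialUnitaryGroup (Fin N) ℂ) → L → SUNCoords N} (hg : Measurable g)
    {S : (L → Matrix.specialUnitaryGroup (Fin N) ℂ) → ℝ} (hS : Measurable S)
    (hSi : Integrable (fun U => Real.exp (-S U))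
      (Measure.pi fun _ : L => haarProbability (Matrix.specialUnitaryGroup (Fin N) ℂ)))
    (hΔ : Integrable (fun z => deltaH (fun z => S z.1 + sunKinetic N z.2)
        (sunLeapfrogProposalN (sunCoordι N) (sunCoordι_skew N) ε g n) z * Real.exp (-(S z.1 + sunKinetic N z.2)))
      ((Measure.pi fun _ : L => haarProbability (Matrix.specialUnitaryGroup (Fin N) ℂ)).prod
        (Measure.pi fun _ : L => μ))) :
    (1 - Real.sqrt (1 - Real.exp (-((∫ z, deltaH (fun z => S z.1 + sunKinetic N z.2)
          (sunLeapfrogProposalN (sunCoordι N) (sunCoordι_skew N) ε g n) z * Real.exp (-(S z.1 + sunKinetic N z.2))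
        ∂((Measure.pi fun _ : L => haarProbability (Matrix.specialUnitaryGroup (Fin N) ℂ)).prod
          (Measure.pi fun _ : L => μ))) /
        ∫ z, Real.exp (-(S z.1 + sunKinetic N z.2))
          ∂((Measure.pi fun _ : L => haarProbability (Matrix.specialUnitaryGroup (Fin N) ℂ)).prod
            (Measure.pi fun _ : L => μ)))))) *
      ∫ z, Real.exp (-(S z.1 + sunKinetic N z.2))
        ∂((Measure.pi fun _ : L => haarProbability (Matrix.specialUnitaryGroup (Fin N) ℂ)).prod
          (Measure.pi fun _ : L => μ)) ≤
    ∫ z, min 1 (Real.exp (-deltaH (fun z => S z.1 + sunKinetic N z.2)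
          (sunLeapfrogProposalN (sunCoordι N) (sunCoordι_skew N) ε g n) z)) * Real.exp (-(S z.1 + sunKinetic N z.2))
      ∂((Measure.pi fun _ : L => haarProbability (Matrix.specialUnitaryGroup (Fin N) ℂ)).prod
        (Measure.pi fun _ : L => μ)) := by
  haveI : SigmaFinite μ := inferInstance
  haveI := neZero_haarPi_prod_pi N μ (L := L)
  have hw := integrable_exp_neg_hamiltonian_sun N μ hSi (L := L)
  have hZ := integral_exp_pos hw
  have key := involutive_acceptance_ge
    (μ := (Measure.pi fun _ : L => haarProbability (Matrix.specialUnitaryGroup (Fin N) ℂ)).prod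
      (Measure.pi fun _ : L => μ))
    (H := fun z => S z.1 + sunKinetic N z.2)
    (Ψ := ⇑(sunLeapfrogProposalN (sunCoordι N) (sunCoordι_skew N) ε g n))
    ((hS.comp measurable_fst).add ((measurable_sunKinetic (L := L) N).comp measurable_snd))
    (measurable_sunLeapfrogProposalN (sunCoordι N) (sunCoordι_skew N) ε n hg)
    (involutive_sunLeapfrogProposalN (sunCoordι N) (sunCoordι_skew N) ε g n)
    (measurePreserving_sunLeapfrogProposalN (sunCoordι N) (sunCoordι_skew N) ε n μ hg) hw hΔ hZ
  exact key

end General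

/-! ## §3 Row 21's arms: the periodic arm with its own Wilson force, the open-boundary arm -/

section Arms

variable (N : ℕ) {d L : ℕ} [NeZero L] (μ : Measure (SUNCoords N)) [μ.IsAddHaarMeasure]

/-- The Boltzmann weight of `β` times the `SU(N)` Wilson action is integrable for product Haar (bounded and measurable
on a probability space). -/
theorem integrable_exp_neg_smul_wilsonAction_sun (β : ℝ) :
    Integrable (fun U : GaugeConfig d L (Matrix.specialUnitaryGroup (Fin N) ℂ) => Real.exp (-(β * wilsonAction (suRep N) U)))
      (Measure.pi fun _ : Edge d L => haarProbability (Matrix.specialUnitaryGroup (Fin N) ℂ)) := by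
  obtain ⟨s, hs⟩ := exists_bound_smul_wilsonAction_sun N (d := d) (L := L) (suRep N) continuous_suRep β
  refine Integrable.mono' (integrable_const (Real.exp s))
    ((continuous_smul_wilsonAction (suRep N) continuous_suRep β).measurable.neg.exp).aestronglyMeasurable
    (ae_of_all _ fun U => ?_)
  rw [Real.norm_eq_abs, abs_of_pos (Real.exp_pos _)]
  exact Real.exp_le_exp.2 (by linarith [(abs_le.1 (hs U)).1])

/-- The Boltzmann weight of `β` times the open-boundary action is integrable for product Haar. -/
theorem integrable_exp_neg_smul_obcAction_sun (τ : Fin d) (β : ℝ) :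
    Integrable (fun U : GaugeConfig d L (Matrix.specialUnitaryGroup (Fin N) ℂ) => Real.exp (-(β * obcAction (suRep N) τ U)))
      (Measure.pi fun _ : Edge d L => haarProbability (Matrix.specialUnitaryGroup (Fin N) ℂ)) := by
  obtain ⟨s, hs⟩ := exists_bound_smul_obcAction (d := d) (L := L) (suRep N) continuous_suRep τ β
  refine Integrable.mono' (integrable_const (Real.exp s))
    (((continuous_obcAction (suRep N) continuous_suRep τ).measurable.const_mul β).neg.exp).aestronglyMeasurable
    (ae_of_all _ fun U => ?_)
  rw [Real.norm_eq_abs, abs_of_pos (Real.exp_pos _)]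
  exact Real.exp_le_exp.2 (by linarith [(abs_le.1 (hs U)).1])

/-- **THE PERIODIC ARM AS RUN (`E2 = PBC-HMC`): ACCEPTANCE `= P(ΔH ≤ 0) + P(ΔH < 0)`** — `S = β·S_W` on the torus
`(ℤ/L)^d`, the engine's own half kick `−(ε/2)·sunWilsonForce N β`, every `β`, `ε`, `n`, `L`. -/
theorem wilsonForce_sunLeapfrogN_acceptance_eq (β ε : ℝ) (n : ℕ) :
    ∫ z, min 1 (Real.exp (-deltaH
          (fun z : GaugeConfig d L (Matrix.specialUnitaryGroup (Fin N) ℂ) × (Edge d L → SUNCoords N) =>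
            β * wilsonAction (suRep N) z.1 + sunKinetic N z.2)
          (sunLeapfrogProposalN (sunCoordι N) (sunCoordι_skew N) ε
            (fun U : GaugeConfig d L (Matrix.specialUnitaryGroup (Fin N) ℂ) => -(ε / 2) • sunWilsonForce N β U) n) z)) *
        Real.exp (-(β * wilsonAction (suRep N) z.1 + sunKinetic N z.2))
      ∂((Measure.pi fun _ : Edge d L => haarProbability (Matrix.specialUnitaryGroup (Fin N) ℂ)).prod
        (Measure.pi fun _ : Edge d L => μ)) =
    (∫ z, (if deltaH
          (fun z : GaugeConfig d L (Matrix.specialUnitaryGroup (Fin N) ℂ) × (Edge d L → SUNCoords N) =>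
            β * wilsonAction (suRep N) z.1 + sunKinetic N z.2)
          (sunLeapfrogProposalN (sunCoordι N) (sunCoordι_skew N) ε
            (fun U : GaugeConfig d L (Matrix.specialUnitaryGroup (Fin N) ℂ) => -(ε / 2) • sunWilsonForce N β U) n) z ≤ 0
          then (1 : ℝ) else 0) *
        Real.exp (-(β * wilsonAction (suRep N) z.1 + sunKinetic N z.2))
      ∂((Measure.pi fun _ : Edge d L => haarProbability (Matrix.specialUnitaryGroup (Fin N) ℂ)).prod
        (Measure.pi fun _ : Edge d L => μ))) +
    ∫ z, (if deltaH
          (fun z : GaugeConfig d L (Matrix.specialUnitaryGroup (Fin N) ℂ) × (Edge d L → SUNCoords N) =>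
            β * wilsonAction (suRep N) z.1 + sunKinetic N z.2)
          (sunLeapfrogProposalN (sunCoordι N) (sunCoordι_skew N) ε
            (fun U : GaugeConfig d L (Matrix.specialUnitaryGroup (Fin N) ℂ) => -(ε / 2) • sunWilsonForce N β U) n) z < 0
          then (1 : ℝ) else 0) *
        Real.exp (-(β * wilsonAction (suRep N) z.1 + sunKinetic N z.2))
      ∂((Measure.pi fun _ : Edge d L => haarProbability (Matrix.specialUnitaryGroup (Fin N) ℂ)).prod
        (Measure.pi fun _ : Edge d L => μ)) :=
  sun_leapfrogN_acceptance_eq N μ ε n (measurable_halfKick_sun N (measurable_sunWilsonForce N (d := d) (L := L) β) ε)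
    (continuous_smul_wilsonAction (suRep N) continuous_suRep β).measurable (integrable_exp_neg_smul_wilsonAction_sun N β)

/-- **THE PERIODIC ARM AS RUN: NEGATIVE TAIL `P(ΔH ≤ −c) ≤ e^{−c}`** (weighted form), every `β`, `ε`, `n`, `L`, `c`. -/
theorem wilsonForce_sunLeapfrogN_negative_tail_le (β ε : ℝ) (n : ℕ) (c : ℝ) :
    ∫ z, (if deltaH
          (fun z : GaugeConfig d L (Matrix.specialUnitaryGroup (Fin N) ℂ) × (Edge d L → SUNCoords N) =>
            β * wilsonAction (suRep N) z.1 + sunKinetic N z.2)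
          (sunLeapfrogProposalN (sunCoordι N) (sunCoordι_skew N) ε
            (fun U : GaugeConfig d L (Matrix.specialUnitaryGroup (Fin N) ℂ) => -(ε / 2) • sunWilsonForce N β U) n) z ≤ -c
          then (1 : ℝ) else 0) *
        Real.exp (-(β * wilsonAction (suRep N) z.1 + sunKinetic N z.2))
      ∂((Measure.pi fun _ : Edge d L => haarProbability (Matrix.specialUnitaryGroup (Fin N) ℂ)).prod
        (Measure.pi fun _ : Edge d L => μ)) ≤
    Real.exp (-c) *
      ∫ z, (if c ≤ deltaH
            (fun z : GaugeConfig d L (Matrix.specialUnitaryGroup (Fin N) ℂ) × (Edge d L → SUNCoords N) =>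
              β * wilsonAction (suRep N) z.1 + sunKinetic N z.2)
            (sunLeapfrogProposalN (sunCoordι N) (sunCoordι_skew N) ε
              (fun U : GaugeConfig d L (Matrix.specialUnitaryGroup (Fin N) ℂ) => -(ε / 2) • sunWilsonForce N β U) n) z
            then (1 : ℝ) else 0) *
          Real.exp (-(β * wilsonAction (suRep N) z.1 + sunKinetic N z.2))
        ∂((Measure.pi fun _ : Edge d L => haarProbability (Matrix.specialUnitaryGroup (Fin N) ℂ)).prod
          (Measure.pi fun _ : Edge d L => μ)) :=
  sun_leapfrogN_negative_tail_le N μ ε n (measurable_halfKick_sun N (measurable_sunWilsonForce N (d := d) (L := L) β) ε)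
    (continuous_smul_wilsonAction (suRep N) continuous_suRep β).measurable (integrable_exp_neg_smul_wilsonAction_sun N β) c

/-- **THE OPEN-BOUNDARY ARM (`OBC-HMC`): ACCEPTANCE `= P(ΔH ≤ 0) + P(ΔH < 0)`** — `S = β·S_OBC` (time direction `τ`),
ANY measurable increment `g`, every `β`, `ε`, `n`. -/
theorem obc_sunLeapfrogN_acceptance_eq (τ : Fin d) (β ε : ℝ) (n : ℕ)
    {g : GaugeConfig d L (Matrix.specialUnitaryGroup (Fin N) ℂ) → Edge d L → SUNCoords N} (hg : Measurable g) :
    ∫ z, min 1 (Real.exp (-deltaH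
          (fun z : GaugeConfig d L (Matrix.specialUnitaryGroup (Fin N) ℂ) × (Edge d L → SUNCoords N) =>
            β * obcAction (suRep N) τ z.1 + sunKinetic N z.2)
          (sunLeapfrogProposalN (sunCoordι N) (sunCoordι_skew N) ε g n) z)) *
        Real.exp (-(β * obcAction (suRep N) τ z.1 + sunKinetic N z.2))
      ∂((Measure.pi fun _ : Edge d L => haarProbability (Matrix.specialUnitaryGroup (Fin N) ℂ)).prod
        (Measure.pi fun _ : Edge d L => μ)) =
    (∫ z, (if deltaH
          (fun z : GaugeConfig d L (Matrix.specialUnitaryGroup (Fin N) ℂ) × (Edge d L → SUNCoords N) =>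
            β * obcAction (suRep N) τ z.1 + sunKinetic N z.2)
          (sunLeapfrogProposalN (sunCoordι N) (sunCoordι_skew N) ε g n) z ≤ 0 then (1 : ℝ) else 0) *
        Real.exp (-(β * obcAction (suRep N) τ z.1 + sunKinetic N z.2))
      ∂((Measure.pi fun _ : Edge d L => haarProbability (Matrix.specialUnitaryGroup (Fin N) ℂ)).prod
        (Measure.pi fun _ : Edge d L => μ))) +
    ∫ z, (if deltaH
          (fun z : GaugeConfig d L (Matrix.specialUnitaryGroup (Fin N) ℂ) × (Edge d L → SUNCoords N) =>
            β * obcAction (suRep N) τ z.1 + sunKinetic N z.2)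
          (sunLeapfrogProposalN (sunCoordι N) (sunCoordι_skew N) ε g n) z < 0 then (1 : ℝ) else 0) *
        Real.exp (-(β * obcAction (suRep N) τ z.1 + sunKinetic N z.2))
      ∂((Measure.pi fun _ : Edge d L => haarProbability (Matrix.specialUnitaryGroup (Fin N) ℂ)).prod
        (Measure.pi fun _ : Edge d L => μ)) :=
  sun_leapfrogN_acceptance_eq N μ ε n hg ((continuous_obcAction (suRep N) continuous_suRep τ).measurable.const_mul β)
    (integrable_exp_neg_smul_obcAction_sun N τ β)

/-- **THE OPEN-BOUNDARY ARM: NEGATIVE TAIL `P(ΔH ≤ −c) ≤ e^{−c}`** (weighted form), any measurable increment, every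
`β`, `ε`, `n`, `c`. -/
theorem obc_sunLeapfrogN_negative_tail_le (τ : Fin d) (β ε : ℝ) (n : ℕ)
    {g : GaugeConfig d L (Matrix.specialUnitaryGroup (Fin N) ℂ) → Edge d L → SUNCoords N} (hg : Measurable g) (c : ℝ) :
    ∫ z, (if deltaH
          (fun z : GaugeConfig d L (Matrix.specialUnitaryGroup (Fin N) ℂ) × (Edge d L → SUNCoords N) =>
            β * obcAction (suRep N) τ z.1 + sunKinetic N z.2)
          (sunLeapfrogProposalN (sunCoordι N) (sunCoordι_skew N) ε g n) z ≤ -c then (1 : ℝ) else 0) *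
        Real.exp (-(β * obcAction (suRep N) τ z.1 + sunKinetic N z.2))
      ∂((Measure.pi fun _ : Edge d L => haarProbability (Matrix.specialUnitaryGroup (Fin N) ℂ)).prod
        (Measure.pi fun _ : Edge d L => μ)) ≤
    Real.exp (-c) *
      ∫ z, (if c ≤ deltaH
            (fun z : GaugeConfig d L (Matrix.specialUnitaryGroup (Fin N) ℂ) × (Edge d L → SUNCoords N) =>
              β * obcAction (suRep N) τ z.1 + sunKinetic N z.2)
            (sunLeapfrogProposalN (sunCoordι N) (sunCoordι_skew N) ε g n) z then (1 : ℝ) else 0) *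
          Real.exp (-(β * obcAction (suRep N) τ z.1 + sunKinetic N z.2))
        ∂((Measure.pi fun _ : Edge d L => haarProbability (Matrix.specialUnitaryGroup (Fin N) ℂ)).prod
          (Measure.pi fun _ : Edge d L => μ)) :=
  sun_leapfrogN_negative_tail_le N μ ε n hg ((continuous_obcAction (suRep N) continuous_suRep τ).measurable.const_mul β)
    (integrable_exp_neg_smul_obcAction_sun N τ β) c

end Arms

end Summit.Ventures.LatticeQCDFlow.Exactness
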